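import Mathlib
import HarnessLib
import Summits.QuantumAdvantage.AdviceFreeQNC0.WalkTransport
import Summits.QuantumAdvantage.AdviceFreeQNC0.SumCodeDegreeZero

/-!
# XorDial, part C/3 (§3 THE MECHANISM: `ringWinU_append` — the win bit of a concatenation `u₁ ++ u₂` is the XOR of the two sub-games played at CROSS-ENCRYPTED charges (`cut_append_left/right/shared`, `fireCount_append`)) — support for item stmt-QuantumAdvantage-26994 (`Theses.FeatureShadow.Target`)

Cell decomp-qadv, seat lens-1 («grading / quantitative ladder»), generation 18 — land port of the node «XorDial» (published under the cell's HOME/decomp-qadv-lens-1/g18/XorDial.lean, record NODE-g18.md, critic row 72v34 VERIFIED-as-LAW; RESIDUAL MODE on AbsorptionDial:26763 / FeatureShadow:26994 / OddPrimeWalk:23109).  The node file with ONLY the namespace renamed `Theses.XorDial → Theorems.XorDial` and split at section boundaries into parts A–C (B imports A; C is independent; NO part imports a route file — the BY-NAME `closes*` stay in the HOME node).  Prop-defs = the node's hardness cells and laws only (`Exc`, `XorLaw`, `CapLaw`, `XorLawCap`, `XorLawOdd`, `XorLawCapOdd`, part A).  Tree facts reused by name, not restated: `LengthDial.HardR/hardR_mono/winCount_le/QuasiLoss/WalkHardF`-side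 lemmas (LengthDialB/C), `adviceFreeQNC0Odd_of_walkHardF`, `wt`, `wtPrefix`, `walkExp`, `ringWinU` (WalkTransport / Elimination).  No `sorry`, no new axioms, no instances, no notation.

PART C CONTENT (independent of A/B): the proved append/split identities behind the law.

NODE SYNOPSIS (all parts):

# XorDial — the θ-AXIS of the odd-prime u-walk rung: a CONCATENATION (XOR) LAW for the game's excess, which PRICES the
loss-grade ladder X < Floor < Q < T and pays exactly the edge the cell's routes leave residual

Cell decomp-qadv, seat lens-1 («grading / quantitative ladder»), generation 18 (+ REV 1: capped law, exact `V₁(8)`).  RESIDUAL MODE.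
Concluded BY NAME (load-bearing law piece = the CAPPED law `XorLawCapOdd`; the sharp law `XorLawOdd` implies it, `xorLawCapOdd_of_xorLawOdd`):
* `closes : XorLawCapOdd → Q → AbsorptionDial.DerandLiftOdd` — the registered residual stmt-QuantumAdvantage-26763
  (`DetSepOdd → AdviceFreeQNC0Odd`, RESIDUAL · NO-SHRINK · BARRIER «no Adleman for FAC⁰[p]») is DISCHARGED under the law
  (the leaf follows from the route's own Q grade on the walk side, so the circuit-side derandomisation is bypassed);
* `closes_T : XorLawCapOdd → Q → FeatureShadow.Target` — the odd Target 26994 `∀ p ≥ 5, WalkHardF p`, value `θ = (2 + max κ ¼)/3`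
  (`closes_T_sharp`: `θ = 3/4` from the sharp law);
* `closes_leaf`, and `closes_chain : NoPerfectPolyOdd → MassLoQuarter → MassHiQuasi → XorLawCapOdd → AdviceFreeQNC0Odd`
  (AbsorptionDial's assembly 28402 with its last two items `QuasiLossBridgeOdd`, `DerandLiftOdd` replaced by the law); `closes_sharp`;
* `closes_door : XorLawCapOdd → Q → OddPrimeWalk.ManyReadersSqrtOdd` — BLOCKER stmt-QuantumAdvantage-23109 (T restricted to a class;
  `manyReadersSqrtOdd_of_target` drops the class hypotheses).
Here `Q := LengthDial.QuasiLoss` (tree decl; verbatim the consequent of 28401 `MassHiQuasi` and the antecedent of 28403).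

## THE AXIS (new by construction)
The cell's theorems on this rung are organised along the LOSS GRADE `θ(n)` of the cell `HardR p n D θ` (LengthDialC):
X one loss (28487) < Floor `2^{n^{1/4}}` losses (28488, ⟸ X PROVED) < Q loss fraction `2^{-polylog}` (28401, residual, lens-5)
< T_poly `1/poly` (26767) < T constant `θ` (26994) < TwoThirds `θ = 2/3 + ε` (named conjecture).  The edges Floor→Q and Q→T are
OPEN; AbsorptionDial sidesteps Q→T by leaving the walk (`Q → DetSepOdd`, PROVED, GradeDial) and pays instead the circuit-side
residual 26763.  This node dials the SAME edge on the walk side: Q→T is AMPLIFICATION OF THE EXCESS, and the dial is the behaviour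
of the NORMALISED EXCESS `E_D(n) := 3·max_c V_D(n,c) − 2` (`E = 1` ⟺ some charge is played perfectly, `E = 0` ⟺ value 2/3) under
CONCATENATION of lengths.  Cells: `Exc p n D E := HardR p n D ((2+E)/3)` (§0).

## THE MECHANISM (PROVED, §3): `ringWinU_append`
For `u = u₁ ++ u₂` (`Fin.append`), the win bit of the length-`(n₁+n₂)` game at charge `c` is the XOR of the PREFIX game
(cuts `0..n₁`, strategy `pre y u₂`) at the ENCRYPTED charge `c + |u₂|` and the SUFFIX game (cuts `n₁..n₁+n₂` re-indexed, shared
cut silenced, strategy `suf y u₁`) at the encrypted charge `c + n₁ + 2|u₁|` — exact equalities of naturals `cut_append_left/right`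
(`walkExp (u₁++u₂) g = walkExp u₁ g + |u₂|` for `g ≤ n₁`, `walkExp (u₁++u₂) (n₁+h) = 2|u₁| + walkExp u₂ h`).  Each half's charge
is keyed by the OTHER half's weight mod 3, a key a low-`𝔽_p`-degree player cannot read (Smolensky), and `ChargeTriple` (tree)
caps a bet on one key value at `2/3`: the value `2/3` is the game's zero, whence the normalisation `E = 3V − 2`.

## THE LAW-BET 𝓛 = `XorLaw p` (§0): `E` IS SUBMULTIPLICATIVE IN THE LENGTH AT FIXED DEGREE
`Exc p n₁ D E₁ → Exc p n₂ D E₂ → Exc p (n₁+n₂) D (E₁·E₂)` (`E₁, E₂ ≥ 0`); deficit form `η₁₂ ≥ η₁ + η₂ − 3η₁η₂`.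
EVIDENCE (num/TABLE.md, engine `num/uwalk.c` exhaustive + independent evaluator `num/check.py`):  D = 0 — `E₀(n) = 4^{−⌊(n−1)/2⌋}`
EXACTLY for `n ≤ 16` (confirms and extends lens-5's closed-form conjecture N9b from `n ≤ 11`), and the law holds for all 64 pairs
`n₁ + n₂ ≤ 16`, with EQUALITY iff `n₁, n₂` are both odd and ratio exactly `1/4` otherwise — the blind game SATURATES the law.
D = 1 (class `{0,1,xᵢ,1−xᵢ}` = all `𝔽_p`-degree-1 Boolean cut functions, `p ≥ 3`) — exact `E₁(n) = 1, 1, 1, .8125, .625, .484375,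
.390625` (`n = 1..7`; identical to lens-5's independent table g26/num/deg1_all.txt — two engines agree on every entry); every law
instance with `n₁ + n₂ ≤ 7` is vacuous (a factor has `E = 1`).  FIRST NON-VACUOUS TESTS = the stated test of the UNDECIDED tag:
`max_c V₁(8,c) ≤ 227/256 (.887)`, `V₁(9) ≤ .836`, `V₁(10) ≤ .797`.  ★ K1 RUN (REV 1, this seat, 128 meet-in-the-middle slices
`num/uwalk d1c 8 c k 64`, logs `num/d1_n8_c{0,2}.log`): EXACT `V₁(8,·) = 183, 183, 188 /256` (c = 0, 1, 2; c = 1 from c = 0 by the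
reversal symmetry `V(n,c) = V(n, −c−n mod 3)`), so `E₁(8) = 13/64 = .203 ≤ E₁(4)² = .66` — the first non-vacuous instance HOLDS with
ratio `.31` (and lens-5's LawPiece bound `212/256` holds too); the local-search values at `n = 8` were optimal.  Remaining finite
tests: `V₁(9)` exact (kit lane; LS floor `352/512`, law bound `428/512`), D = 2 at lengths 7..14 (class enumerator of lens-5).
K3 JUNCTION PROBE (REV 2, `num/uprod.c`): at `8 = 4 + 4` the best PRODUCT-FORM degree-1 strategy (prefix cuts read only prefix bits,
suffix cuts only suffix bits) wins `181 / 177` of 256 (c = 0 / 2) against the global `183 / 188`: cross-junction reading is worth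
`+2 / +11`, every global optimum reads across the cut, and both sit far below the law's `227` — independent play at the ENCRYPTED
charges realises `E ≈ .07–.12`, cross-reading `.14–.20`, the law allows `.66`.

## NODE EQUATIONS (0 sorry) and LADDER PRICING (the lens-1 content)
* `walkHardF_of_law : 5 ≤ p → XorLaw p → Q → WalkHardF p` (§2): base `n :=` the largest `m` with `m·2^((log₂ m)^A+2) ≤ N`
  (`Nat.findGreatest`); `exc_iter`/`exc_of_le` (iteration and LENGTH MONOTONICITY from the law), `exc_far` (Bernoulli: a cell of
  excess `1 − 2^{−j}` at length `n` gives value `≤ 3/4` at every `N ≥ n·2^{j+2}`, same degree), `log_transfer` (maximality of `n`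
  keeps `(log₂ N)^{C'} ≤ (log₂ n)^{2(A+1)C'}`).
* PRICING: under 𝓛 the ladder collapses EXACTLY from Q upward.  With `j = (log₂ n)^A` (grade Q) the degree stays polylogarithmic in
  `N` ⟹ T (proved); with `j = n − n^{1/4}` (Floor) or `j = n` (X) the reachable lengths are `N ≥ 2^{n}`, i.e. degree `(log log N)^C`
  only — the law does NOT lift X or Floor to T (growth-rate remark, not typed): 28401 (Floor → Q) is exactly the residual the law
  cannot pay and 26763 the one it pays.  `pieceQ_of_target : Target → Q` (Q is T-implied; `A = 1`, `θ ≤ 1 − 2^{−log₂ n}`).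

## PIECES AND TAGS (target 26763, placed in 26994 / the leaf)
* Q = `LengthDial.QuasiLoss` — [WEAKER than T (`pieceQ_of_target`; the converse IS the amplification edge: probe `Q ⊢ T` fails,
  crux probe vs T and vs 26763 CLEAN) · UNDECIDED · leaf IDEA-NEEDED — it is AbsorptionDial's own open junction (⟸ X ∧ 28488 ∧ 28401),
  NOT a new item; evidence for Q ≢ T: no amplification theorem for polylog-degree strategies is known and Q follows from the floor
  ladder under 28401 while T does not (GradeDial/ScaleDial records)].
* 𝓛_cap = `XorLawCapOdd` (`∀ p ≥ 5, ∃ κ < 1, CapLaw p κ`: `Exc n₁ D E₁ → Exc n₂ D E₂ → Exc (n₁+n₂) D (max κ (E₁E₂))`) — the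
  LOAD-BEARING law piece [UNDECIDED · law-type: NOT T-implied (must-fail `T ⊢ 𝓛_cap`, P12) and ⊬ T (P11), ⊬ Q (P13), Q ⊬ 𝓛_cap (P14),
  not cheaply provable with a trivial cap / refutable (P15/P16), ⊬ the sharp law (P17), ⊬ 26763 (P18); crux probes vs T / vs 26763
  CLEAN · near `E = 1` it coincides with the sharp law (deficits of near-perfect play ADD: `η₁₂ ≥ η₁ + η₂ − 3η₁η₂`), below the cap it
  claims nothing · refutable only by violating families with `E₁E₂ → 1` (test K3) — every finite violation at product value `v`
  still certifies `κ ≥ v` · leaf IDEA-NEEDED (an XOR lemma for cross-keyed halves) / INSTRUMENTABLE through its sharp instances].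
* 𝓛 = `XorLawOdd` (cap `0`) — the ELEGANT STRENGTHENING, not load-bearing [UNDECIDED · implies 𝓛_cap (`xorLawCapOdd_of_xorLawOdd`,
  control 2 of bc/Probe.lean) · rung D = 0 EXACT with EQUALITY at odd+odd (data) · D = 1 first instance PASSED (K1 above) ·
  INSTRUMENTABLE (every finite instance is a finite computation) · caveat: with Q it forces `E_D(N) ≤ E_D(n)^{⌊N/n⌋}` at polylog
  degree — an exponentially small excess, i.e. a correlation bound for log-degree polynomials, BEYOND the catalogued technique
  (see BARRIERS); that overshoot is why the cap is the piece].
HONEST LIMITS. (1) SHARPNESS: the bootstrap from Q needs constant exactly 1 near `E = 1` in either law (deficits must ADD under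
concatenation); any slack `E₁₂ ≤ K·E₁E₂`, `K > 1`, does not bootstrap from a `2^{-polylog}` deficit — constant 1 ATTAINED is what
D = 0 shows.  (2) NO DEGREE LOSS across the cut (degree `D` on both sides) — the feature that separates both laws from LengthDial's
PROVED peel law (degree cost per bit) and makes them bets, squarely inside the question «does concatenation need regularity?».
(3) `closes` consumes only the self-concatenation instances `(k·n, n)` and padding `(N − m, m)` of the law (`excCap_iter`,
`excCap_of_le`), at ONE degree `(log₂ n)^{2(A+1)C'}` per target degree.

## WHY EACH PIECE IS STRICTLY WEAKER / INDEPENDENT; DISTRIBUTED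
Q ⟸ T kernel; T ⟸ Q open (= amplification); 𝓛 independent of T and of Q (probes).  DISTRIBUTED: Q is a COUNTING problem at one
length (absorption / slicing / switching: lens-5, AbsorptionDial, ScaleDial), 𝓛 is a PRODUCT statement across a cut (XOR-lemma /
direct-product technology for low-degree polynomials: Viola–Wigderson «Norms, XOR lemmas, and lower bounds for GF(2) polynomials»
ToC 2008 Thm 1.1–1.2, Bogdanov–Viola FOCS 2007, Smolensky 1987 for the key-unreadability heuristic; none of them is about a game
with cross-encrypted halves — the delta).  Different problems, different tools; neither piece is a parameter value of the other.

## WHY NOVEL (by construction, vs the other five lenses' latest nodes and the cell's product nodes)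
LengthDial / SyndeticDial (lens-5 g26 / g27): LOSSLESS one-bit PEEL law resp. frozen-prefix WINDOW law on the length(-set) axis —
WHICH lengths are hard (i.o. → a.e., syndetic gaps), degree cost per peeled bit, window Floor→Q.  ProductDial / PencilDial (p = 3): direct product ACROSS DISJOINT RINGS (independent instances, joint strategies,
T* = MultiRingHard3).  PumpDial (lens-4 g25): sparsity pumping B_K ⟸ BASE ∧ PUMP.  FrameCertificate / QuarticDial (lens-3):
certificate / class ladders at the root grain.  FieldColumns (lens-6 g18): column restrictions of 32604.  XorDial amplifies WITHIN ONE
INSTANCE along a cut of the SAME ring — the halves are NOT independent (cross-encrypted charges, `ringWinU_append`) — and its law is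
about HOW HARD (the value's excess over 2/3), window Q→T→2/3.  No cell node types an amplification law for the excess; the census
BLOCKERS table (v10) lists «count → fraction → constant» as the untyped content behind 26763 / 26994 / 23109.

## BARRIERS
technique_class: hardness amplification / XOR (concatenation) law for a low-degree polynomial GAME.  NonclassicalDegreeLogBarrier
(polylog-degree regularity constants grow with n): both laws are stated per degree with no loss in D and do not pass through
regularity or switching — honest: that is the bet (D = 0 exact, D = 1 first instance passed).  CORRELATION-BOUNDS BARRIER for
polynomials of degree ≥ log n (Razborov–Smolensky reach error `1/2 − O(d/√n)` only; exponentially small correlation for log-degree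
`𝔽_p`-polynomials is the open problem behind PRGs for AC⁰[p] — Viola–Wigderson ToC 2008 §1, Bogdanov–Viola): T and Q are
CONSTANT- resp. `2^{-polylog}`-error statements and sit on the near side; 𝓛_cap ∧ Q yields only constant error (`θ < 1`), near
side; the SHARP law with Q would put an exponentially small excess at polylog degree on the far side — declared, and the reason the
capped law carries `closes`.  Smolensky/Razborov enter only as the heuristic for the zero `2/3`.
Relativisation / algebrisation (A03-type) barriers do not quantify over this finite game.  Negatives index (`ledger negatives`,
this session): 6 refuted statements (15712, 8592, 2202, 1244, 1615, 9863), none about the u-walk game or products/concatenations of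
it; 𝓛 names no hand-picked constant (typing rule 4c(iv)): its only constants are the game's own `2/3` and the multiplicative unit.

## REPAIR CENSUS (doors tried; detail NODE-g18.md)
value peel on p (g16 ModulusDial: LADDER) · windows of MesoHi3 (g13 RateDial: LAW-LADDER) · restriction splits of 22907 (g15: win-neutral
surgery ⇒ generic ≡ T) · monotone gradings C / pattern / rate / time (g14–g17: top grade ≡ T) · halving-as-RESTRICTION (≡ lens-5's peel
axis; kept only as the mechanism) · direct product across rings (ProductDial's T*, taken) · law + PROVED base only (`degZeroHard`):
the law alone would have to reach T (overshoot / strengthening, PumpDial c2) ⇒ paired with the OPEN weaker Q instead ·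
success-probability grading of 26763 (Adleman's union bound gives the `1 − 2^{−n}` grade for free and every lower grade IS a walk-side
loss grade by averaging ⇒ the circuit dial reduces to this one).

## KILL / DECIDE TESTS
K1 ★ DONE (REV 1): exact `V₁(8,·) = 183, 183, 188 /256` — the sharp law's first non-vacuous instance holds (`13/64 ≤ .66`).  K1′:
`V₁(9)` exact (kit lane; dies iff `> 428/512`; LS floor 352).  K2 D = 2 (`𝔽₅`-degree-2 Boolean = integer-degree-2 class, lens-5
enumerator): first `n` with `E₂(n) < 1` (n ∈ {7, 8}?) then `E₂(2n) ≤ E₂(n)²`.  K3 structural — the ONLY way to refute 𝓛_cap: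
a family of near-perfect concatenations beating the product, i.e. strategies on `u₁ ++ u₂` that read BOTH keys `|u₁|, |u₂| mod 3`
at the junction with vanishing deficit — a refuter's first gadget is a degree-2 «key exchange» across the cut at 4 + 4, then at
growing degree `D ≈ n/2` where each half alone is nearly perfect.

Tree facts reused by name: `LengthDial.HardR / winCount / winCount_le / hardR_mono / QuasiLoss / massHiQuasi_unfold` (LengthDialB/C/G),
`adviceFreeQNC0Odd_of_walkHardF` (AdviceFreeQNC0Odd), `wt`, `wtPrefix`, `walkExp`, `ringWinU` (Elimination / WalkTransport).
No `sorry`, no new axioms, no instances, no notation.  Namespace `Summit.QuantumAdvantage.QuantumAdvantage.Theses.XorDial`.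
-/

set_option autoImplicit false
set_option linter.unusedVariables false
set_option linter.style.longLine false
set_option linter.dupNamespace false

namespace Summit.QuantumAdvantage.QuantumAdvantage.Theorems.XorDial

open Finset
open Summit.QuantumAdvantage.AdviceFreeQNC0

/-! ## §3 THE MECHANISM (proved): concatenation = two games with cross-encrypted charges

For a concatenated input `u = u₁ ++ u₂` (`Fin.append`), the walk exponent of the length-`(n₁+n₂)` game splits EXACTLY:
prefix cuts `g ≤ n₁` see the `u₁`-game at the ENCRYPTED charge `c + |u₂|`, suffix cuts `n₁ + h` see the `u₂`-game at the
encrypted charge `c + n₁ + 2|u₁|` (`cut_append_left/right`, equalities of naturals, hence of the residues mod 3 the cuts test).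
So WIN(n₁+n₂, c) is the XOR of a `u₁`-game whose charge is a function of `|u₂| mod 3` and a `u₂`-game whose charge is a function
of `|u₁| mod 3` — the two keys a low-degree player cannot read (Smolensky); `ChargeTriple` caps play that bets on one key at 2/3.
This is the dictionary behind the law's normalisation `E = 3V − 2` and behind its exactness at `D = 0`. -/

section Append
variable {n₁ n₂ : ℕ}

/-- weight of a concatenation. -/
theorem wt_append (u₁ : Fin n₁ → Bool) (u₂ : Fin n₂ → Bool) : wt (Fin.append u₁ u₂) = wt u₁ + wt u₂ := by
  unfold wt
  rw [Finset.card_filter, Finset.card_filter, Finset.card_filter, Fin.sum_univ_add]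
  simp [Fin.append_left, Fin.append_right]

/-- prefix weights of a concatenation, prefix part. -/
theorem wtPrefix_append_left (u₁ : Fin n₁ → Bool) (u₂ : Fin n₂ → Bool) {g : ℕ} (hg : g ≤ n₁) :
    wtPrefix (Fin.append u₁ u₂) g = wtPrefix u₁ g := by
  unfold wtPrefix
  rw [Finset.card_filter, Finset.card_filter, Fin.sum_univ_add]
  have h2 : ∑ j : Fin n₂, (if (Fin.natAdd n₁ j).val < g ∧ Fin.append u₁ u₂ (Fin.natAdd n₁ j) = true then 1 else 0) = 0 := by
    apply Finset.sum_eq_zero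
    intro j _
    rw [if_neg]
    rintro ⟨h, _⟩
    rw [Fin.val_natAdd] at h
    omega
  rw [h2, add_zero]
  apply Finset.sum_congr rfl
  intro i _
  simp [Fin.append_left]

/-- prefix weights of a concatenation, suffix part. -/
theorem wtPrefix_append_right (u₁ : Fin n₁ → Bool) (u₂ : Fin n₂ → Bool) (h : ℕ) :
    wtPrefix (Fin.append u₁ u₂) (n₁ + h) = wt u₁ + wtPrefix u₂ h := by
  unfold wtPrefix wt
  rw [Finset.card_filter, Finset.card_filter, Finset.card_filter, Fin.sum_univ_add]
  congr 1
  · apply Finset.sum_congr rfl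
    intro i _
    have hi : (i : ℕ) < n₁ + h := by omega
    simp [Fin.append_left, hi]
  · apply Finset.sum_congr rfl
    intro j _
    have hj : ((Fin.natAdd n₁ j).val < n₁ + h) ↔ (j.val < h) := by rw [Fin.val_natAdd]; omega
    simp [Fin.append_right]

/-- walk exponent of a concatenation at a prefix cut. -/
theorem walkExp_append_left (u₁ : Fin n₁ → Bool) (u₂ : Fin n₂ → Bool) {g : ℕ} (hg : g ≤ n₁) :
    walkExp (Fin.append u₁ u₂) g = walkExp u₁ g + wt u₂ := by
  unfold walkExp
  rw [wt_append, wtPrefix_append_left u₁ u₂ hg]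
  ring

/-- walk exponent of a concatenation at a suffix cut. -/
theorem walkExp_append_right (u₁ : Fin n₁ → Bool) (u₂ : Fin n₂ → Bool) (h : ℕ) :
    walkExp (Fin.append u₁ u₂) (n₁ + h) = 2 * wt u₁ + walkExp u₂ h := by
  unfold walkExp
  rw [wt_append, wtPrefix_append_right]
  ring

/-- **CHARGE ENCRYPTION, prefix**: cut `g ≤ n₁` of the concatenated game at charge `c` tests exactly what cut `g` of the
`u₁`-game tests at charge `c + |u₂|`. -/
theorem cut_append_left (c : ℕ) (u₁ : Fin n₁ → Bool) (u₂ : Fin n₂ → Bool) {g : ℕ} (hg : g ≤ n₁) :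
    c + g + walkExp (Fin.append u₁ u₂) g = (c + wt u₂) + g + walkExp u₁ g := by
  rw [walkExp_append_left u₁ u₂ hg]
  ring

/-- **CHARGE ENCRYPTION, suffix**: cut `n₁ + h` of the concatenated game at charge `c` tests exactly what cut `h` of the
`u₂`-game tests at charge `c + n₁ + 2|u₁|`. -/
theorem cut_append_right (c : ℕ) (u₁ : Fin n₁ → Bool) (u₂ : Fin n₂ → Bool) (h : ℕ) :
    c + (n₁ + h) + walkExp (Fin.append u₁ u₂) (n₁ + h) = (c + n₁ + 2 * wt u₁) + h + walkExp u₂ h := by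
  rw [walkExp_append_right]
  ring

/-- the SHARED cut `g = n₁` is consistent: both readings test the same residue (`h = 0`). -/
theorem cut_append_shared (c : ℕ) (u₁ : Fin n₁ → Bool) (u₂ : Fin n₂ → Bool) :
    (c + wt u₂) + n₁ + walkExp u₁ n₁ = (c + n₁ + 2 * wt u₁) + 0 + walkExp u₂ 0 := by
  unfold walkExp wtPrefix wt
  have h1 : (univ.filter fun i : Fin n₁ => i.val < n₁ ∧ u₁ i = true) = (univ.filter fun i : Fin n₁ => u₁ i = true) := by
    ext i; simp
  have h2 : (univ.filter fun i : Fin n₂ => i.val < 0 ∧ u₂ i = true) = ∅ := by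
    ext i; simp
  rw [h1, h2, Finset.card_empty]
  ring

end Append

/-! ### The XOR decomposition of the win bit -/

section Split
variable {n₁ n₂ : ℕ}

/-- the PREFIX GAME of a concatenated-game strategy (cuts `0..n₁`, the suffix input frozen). -/
def pre (y : Fin (n₁ + n₂ + 1) → (Fin (n₁ + n₂) → Bool) → Bool) (u₂ : Fin n₂ → Bool) :
    Fin (n₁ + 1) → (Fin n₁ → Bool) → Bool :=
  fun g v => y ⟨g.val, by omega⟩ (Fin.append v u₂)

/-- the SUFFIX GAME of a concatenated-game strategy (cuts `n₁..n₁+n₂` re-indexed `0..n₂`, the prefix input frozen, the SHARED cut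
`n₁ ↦ 0` silenced — it is counted in the prefix game). -/
def suf (y : Fin (n₁ + n₂ + 1) → (Fin (n₁ + n₂) → Bool) → Bool) (u₁ : Fin n₁ → Bool) :
    Fin (n₂ + 1) → (Fin n₂ → Bool) → Bool :=
  fun h v => if h.val = 0 then false else y ⟨n₁ + h.val, by omega⟩ (Fin.append u₁ v)

/-- the firing count of the concatenated game splits into the prefix-game count (encrypted charge `c + |u₂|`) plus the
suffix-game count (encrypted charge `c + n₁ + 2|u₁|`). -/
theorem fireCount_append (c : ℕ) (y : Fin (n₁ + n₂ + 1) → (Fin (n₁ + n₂) → Bool) → Bool)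
    (u₁ : Fin n₁ → Bool) (u₂ : Fin n₂ → Bool) :
    (univ.filter fun g : Fin (n₁ + n₂ + 1) =>
        y g (Fin.append u₁ u₂) = true ∧ (c + g.val + walkExp (Fin.append u₁ u₂) g.val) % 3 ≠ 0).card
      = (univ.filter fun g : Fin (n₁ + 1) =>
          pre y u₂ g u₁ = true ∧ ((c + wt u₂) + g.val + walkExp u₁ g.val) % 3 ≠ 0).card
        + (univ.filter fun h : Fin (n₂ + 1) =>
          suf y u₁ h u₂ = true ∧ ((c + n₁ + 2 * wt u₁) + h.val + walkExp u₂ h.val) % 3 ≠ 0).card := by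
  set A := univ.filter (fun g : Fin (n₁ + n₂ + 1) =>
        y g (Fin.append u₁ u₂) = true ∧ (c + g.val + walkExp (Fin.append u₁ u₂) g.val) % 3 ≠ 0) with hA
  rw [← Finset.card_filter_add_card_filter_not (s := A) (fun g : Fin (n₁ + n₂ + 1) => g.val ≤ n₁)]
  congr 1
  · symm
    apply Finset.card_bij (fun (g : Fin (n₁ + 1)) _ => (⟨g.val, by omega⟩ : Fin (n₁ + n₂ + 1)))
    · intro g hg
      rw [Finset.mem_filter] at hg
      rw [Finset.mem_filter, hA, Finset.mem_filter]
      refine ⟨⟨Finset.mem_univ _, hg.2.1, ?_⟩, ?_⟩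
      · have := cut_append_left c u₁ u₂ (show g.val ≤ n₁ by omega)
        rw [this]; exact hg.2.2
      · show g.val ≤ n₁; omega
    · intro g₁ _ g₂ _ h
      exact Fin.ext (by simpa using congrArg Fin.val h)
    · intro b hb
      rw [Finset.mem_filter, hA, Finset.mem_filter] at hb
      refine ⟨⟨b.val, by omega⟩, ?_, Fin.ext rfl⟩
      rw [Finset.mem_filter]
      refine ⟨Finset.mem_univ _, ?_, ?_⟩
      · have e : (⟨b.val, by omega⟩ : Fin (n₁ + n₂ + 1)) = b := Fin.ext rfl
        show y ⟨b.val, _⟩ (Fin.append u₁ u₂) = true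
        rw [e]; exact hb.1.2.1
      · rw [← cut_append_left c u₁ u₂ hb.2]; exact hb.1.2.2
  · symm
    apply Finset.card_bij (fun (h : Fin (n₂ + 1)) _ => (⟨n₁ + h.val, by omega⟩ : Fin (n₁ + n₂ + 1)))
    · intro h hh
      rw [Finset.mem_filter] at hh
      have h0 : h.val ≠ 0 := by
        intro h0
        have := hh.2.1
        simp [suf, h0] at this
      have hy : y ⟨n₁ + h.val, by omega⟩ (Fin.append u₁ u₂) = true := by
        have := hh.2.1
        simpa [suf, h0] using this
      rw [Finset.mem_filter, hA, Finset.mem_filter]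
      refine ⟨⟨Finset.mem_univ _, hy, ?_⟩, ?_⟩
      · have := cut_append_right c u₁ u₂ h.val
        show (c + (n₁ + h.val) + walkExp (Fin.append u₁ u₂) (n₁ + h.val)) % 3 ≠ 0
        rw [this]; exact hh.2.2
      · show ¬ (n₁ + h.val ≤ n₁); omega
    · intro h₁ _ h₂ _ h
      exact Fin.ext (by simpa using congrArg Fin.val h)
    · intro b hb
      rw [Finset.mem_filter, hA, Finset.mem_filter] at hb
      have hbv : n₁ < b.val := by have := hb.2; omega
      refine ⟨⟨b.val - n₁, by omega⟩, ?_, Fin.ext (by simp; omega)⟩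
      rw [Finset.mem_filter]
      have e : (⟨n₁ + (b.val - n₁), by omega⟩ : Fin (n₁ + n₂ + 1)) = b := Fin.ext (by simp; omega)
      refine ⟨Finset.mem_univ _, ?_, ?_⟩
      · show (if b.val - n₁ = 0 then false else y ⟨n₁ + (b.val - n₁), _⟩ (Fin.append u₁ u₂)) = true
        rw [if_neg (by omega), e]; exact hb.1.2.1
      · show ((c + n₁ + 2 * wt u₁) + (b.val - n₁) + walkExp u₂ (b.val - n₁)) % 3 ≠ 0
        rw [← cut_append_right c u₁ u₂ (b.val - n₁)]
        have e' : n₁ + (b.val - n₁) = b.val := by omega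
        rw [e']; exact hb.1.2.2

/-- **THE XOR DECOMPOSITION**: the win bit of the concatenated game is the XOR of the prefix game at charge `c + |u₂|` and the
suffix game (shared cut silenced) at charge `c + n₁ + 2|u₁|`. -/
theorem ringWinU_append (c : ℕ) (y : Fin (n₁ + n₂ + 1) → (Fin (n₁ + n₂) → Bool) → Bool)
    (u₁ : Fin n₁ → Bool) (u₂ : Fin n₂ → Bool) :
    ringWinU c y (Fin.append u₁ u₂)
      = xor (ringWinU (c + wt u₂) (pre y u₂) u₁) (ringWinU (c + n₁ + 2 * wt u₁) (suf y u₁) u₂) := by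
  unfold ringWinU
  rw [fireCount_append, Summit.QuantumAdvantage.AdviceFreeQNC0.SumCodeZero.decide_add_mod_two]

end Split

end Summit.QuantumAdvantage.QuantumAdvantage.Theorems.XorDial
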